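import Mathlib
import Summits.AtomisticToContinuum.Crystallization.Theses.PoissonBesselStacking
import Literature.MathematicalPhysics.StatisticalMechanics.BarlowStacking
import Literature.MathematicalPhysics.StatisticalMechanics.BarlowStackingEnergy
import Literature.MathematicalPhysics.StatisticalMechanics.HaggStacking

/-!
# Route PricedLinkCensus — pricing the ideal uniform polytypes against relaxed hcp
(`StackingHinge`, line Sketch; stub `stub_idealPolytypePricing` of stmt-AtomisticToContinuum-14993)

The IDEAL sub-case of the priced inequality of the line.  Fix a box scale `(a₀, h₀)` carrying a
strict modulus `c > 0` of the hcp energy on the box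
`B = {47/50 ≤ a ≤ 1, 39/50·a ≤ h ≤ 17/20·a}` (`e(hcp a₀ h₀) + c·|Δ|² ≤ e(hcp a h)` on `B`), a scale
`(a, h) ∈ B` at which the Lennard-Jones registry couplings `J = barlowCoupling lennardJones a h`
satisfy the domination instance `Σ k|J_k| < ∞`, `J₂ < 0`, `Σ_{k≥3}(k−1)|J_k| ≤ |J₂|/2`, and a
window `(R, ε)`.  Then some `κ > 0` prices EVERY exact uniform Barlow stacking
`Q = barlowPeriodicConfiguration s ha hh hp hs` (`s` a `p`-periodic Hägg word):

  `κ · #U_Q ≤ p · (e(Q) − e(hcp a₀ h₀))`,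

`#U_Q` the number of motif points of `Q` whose `R`-window in `Q.points` is not two-way `ε`-matched
with a rigid image of `barlowStacking a₀ h₀ alternatingHagg`.

The three structural inputs are HYPOTHESES (each proved elsewhere in the tree):
* the per-period WORD EXCESS `p·Σ_{k≥2 even} J_k + b_p·γ ≤ H_p(J, s)`,
  `γ = −J₂ − Σ_{k≥3}(k−1)|J_k|`, `b_p = #{m < p : s (m+1) = s m}` (`stub_periodicWordExcess`);
* the GEOMETRY `#U_Q ≤ (2K+1)·b_p` once `|a − a₀|, |h − h₀| ≤ δ` (`stub_unmatchedNearBadBond`);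
* `BarlowEnergyIdentification` (item 3065): `e(Q) = e₀(a,h) + H_p(J, s)/p`.

Proof.  By the energy identification for `s` and for `alternatingHagg` (period `2`,
`haggEnergy_alternating`; `hcpPeriodicConfiguration ha hh` IS the periodic configuration of the
alternating word), `p·(e(Q) − e(hcp a h)) = H_p − p·Σ_even J ≥ b_p·γ ≥ b_p·|J₂|/2`, and
`e(hcp a h) ≥ e(hcp a₀ h₀) + c·((a−a₀)² + (h−h₀)²)`.  With
`κ = min (|J₂|/(2(2K+1))) (c·δ²)`: if the scale is `δ`-close, `κ·#U ≤ κ(2K+1)b_p ≤ b_p|J₂|/2`;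
otherwise `(a−a₀)² + (h−h₀)² ≥ δ²` and `#U ≤ #motif ≤ p`, so `κ·#U ≤ c δ² p`.  Both are
`≤ p·(e(Q) − e(hcp a₀ h₀))` (`pricing_arith`).

All `[folklore]`.
-/

namespace Summit.AtomisticToContinuum.Crystallization.Theorems.PricedHcpWindowsIdealPricing

open Literature.MathematicalPhysics.StatisticalMechanics

/-- **The arithmetic of the two pricing mechanisms.**  With `U` the unmatched count, `b ≥ 0` the
bad-bond count, `p > 0` the period, the word excess `p·Se + b·(−J2 − T) ≤ Hp` with `J2 < 0`,
`T ≤ |J2|/2`, the energies `E = e₀ + Hp/p`, `Ehcp = e₀ + Se`, the modulus `Ehcp₀ + c·D ≤ Ehcp`, and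
the dichotomy (`Close → U ≤ (2K+1)·b`, `¬ Close → δ² ≤ D`, always `U ≤ p`):
`min (|J2|/(2(2K+1))) (c δ²) · U ≤ p · (E − Ehcp₀)`. [folklore] -/
theorem pricing_arith {Close : Prop} {U b p T J2 Se Hp e₀ E Ehcp Ehcp₀ c D δ : ℝ} {K : ℕ}
    (hU0 : 0 ≤ U) (hUp : U ≤ p) (hb : 0 ≤ b) (hp : 0 < p)
    (hJ2 : J2 < 0) (hT : T ≤ 1 / 2 * |J2|)
    (hword : p * Se + b * (-J2 - T) ≤ Hp)
    (hE : E = e₀ + Hp / p) (hEhcp : Ehcp = e₀ + Se)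
    (hmod : Ehcp₀ + c * D ≤ Ehcp) (hc : 0 < c) (hδ : 0 < δ) (hD : 0 ≤ D)
    (hclose : Close → U ≤ (2 * (K : ℝ) + 1) * b) (hfar : ¬ Close → δ ^ 2 ≤ D) :
    min (|J2| / (2 * (2 * (K : ℝ) + 1))) (c * δ ^ 2) * U ≤ p * (E - Ehcp₀) := by
  have hA : |J2| = -J2 := abs_of_neg hJ2
  have hγ : |J2| / 2 ≤ -J2 - T := by linarith
  have hγ0 : 0 ≤ -J2 - T := by linarith [abs_nonneg J2]
  have hpE : p * E = p * e₀ + Hp := by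
    rw [hE, mul_add, mul_div_cancel₀ _ hp.ne']
  have hpEhcp : p * Ehcp = p * e₀ + p * Se := by rw [hEhcp]; ring
  have hpmod : p * (Ehcp₀ + c * D) ≤ p * Ehcp := mul_le_mul_of_nonneg_left hmod hp.le
  -- the common lower bound `b·γ + p·c·D ≤ p·(E − Ehcp₀)`
  have hmain : b * (-J2 - T) + p * (c * D) ≤ p * (E - Ehcp₀) := by linarith
  by_cases hcl : Close
  · -- WORD mechanism: `κ·U ≤ |J2|/(2(2K+1)) · (2K+1) b = b|J2|/2 ≤ b γ`
    have hUb := hclose hcl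
    calc min (|J2| / (2 * (2 * (K : ℝ) + 1))) (c * δ ^ 2) * U
        ≤ |J2| / (2 * (2 * (K : ℝ) + 1)) * ((2 * (K : ℝ) + 1) * b) :=
          mul_le_mul (min_le_left _ _) hUb hU0 (by positivity)
      _ = |J2| / 2 * b := by field_simp
      _ ≤ (-J2 - T) * b := mul_le_mul_of_nonneg_right hγ hb
      _ ≤ p * (E - Ehcp₀) := by nlinarith [mul_nonneg hp.le (mul_nonneg hc.le hD)]
  · -- SCALE mechanism: `κ·U ≤ c δ² · p ≤ p c D`
    have hDδ := hfar hcl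
    calc min (|J2| / (2 * (2 * (K : ℝ) + 1))) (c * δ ^ 2) * U
        ≤ c * δ ^ 2 * p := mul_le_mul (min_le_right _ _) hUp hU0 (by positivity)
      _ ≤ c * D * p := by gcongr
      _ ≤ p * (E - Ehcp₀) := by nlinarith [mul_nonneg hb hγ0]

/-- A scale that is not `δ`-close to `(a₀, h₀)` in both coordinates (`δ > 0`) is `δ`-far in the
Euclidean square norm: `δ² ≤ (a − a₀)² + (h − h₀)²`. [folklore] -/
theorem sq_le_of_not_close {a a₀ h h₀ δ : ℝ} (hδ : 0 < δ)
    (hfar : ¬ (|a - a₀| ≤ δ ∧ |h - h₀| ≤ δ)) :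
    δ ^ 2 ≤ (a - a₀) ^ 2 + (h - h₀) ^ 2 := by
  rcases not_and_or.1 hfar with h1 | h1
  · have h2 : δ ^ 2 ≤ |a - a₀| ^ 2 := pow_le_pow_left₀ hδ.le (not_le.1 h1).le 2
    rw [sq_abs] at h2
    nlinarith [sq_nonneg (h - h₀)]
  · have h2 : δ ^ 2 ≤ |h - h₀| ^ 2 := pow_le_pow_left₀ hδ.le (not_le.1 h1).le 2
    rw [sq_abs] at h2
    nlinarith [sq_nonneg (a - a₀)]

/-- **At most `p` motif points.**  The motif of `barlowPeriodicConfiguration s ha hh hp hs` is the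
image of `range p` under `m ↦ barlowPos a h s m 0 0`, so any subtype of it has at most `p` elements
(stated with the real cast used by the line). [folklore] -/
theorem natCard_motif_subtype_le {a h : ℝ} (ha : a ≠ 0) (hh : h ≠ 0) {p : ℕ} (hp : p ≠ 0)
    {s : ℤ → ℤ} (hs : ∀ i : ℤ, s (i + p) = s i)
    (P : (barlowPeriodicConfiguration s ha hh hp hs).motif → Prop) :
    (Nat.card {x : (barlowPeriodicConfiguration s ha hh hp hs).motif // P x} : ℝ) ≤ p := by
  have h1 : Nat.card {x : (barlowPeriodicConfiguration s ha hh hp hs).motif // P x} ≤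
      Nat.card (barlowPeriodicConfiguration s ha hh hp hs).motif :=
    Finite.card_subtype_le P
  have h2 : Nat.card (barlowPeriodicConfiguration s ha hh hp hs).motif =
      (barlowPeriodicConfiguration s ha hh hp hs).motif.card :=
    Nat.card_eq_finsetCard _
  have h3 : (barlowPeriodicConfiguration s ha hh hp hs).motif.card ≤ p := by
    show ((Finset.range p).image fun m : ℕ => barlowPos a h s m 0 0).card ≤ p
    exact Finset.card_image_le.trans (Finset.card_range p).le
  exact_mod_cast (h1.trans_eq h2).trans h3

/-- **stub_idealPolytypePricing** (ASSEMBLY OF THE IDEAL SUB-CASE).  Hypotheses: the word price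
per period (verbatim `stub_periodicWordExcess`'s conclusion), the geometry (verbatim
`stub_unmatchedNearBadBond`), `BarlowEnergyIdentification` (item 3065), a box point `(a₀, h₀)`
with a STRICT modulus `c > 0` (`e(hcp a₀ h₀) + c·|Δ|² ≤ e(hcp a h)` on the box), and at the box
scale `(a, h)` the domination instance (`Σ k|J_k| < ∞`, `J₂ < 0`, `Σ_{k≥3}(k−1)|J_k| ≤ |J₂|/2`,
`J = barlowCoupling lennardJones a h`).  Conclusion: for every window `(R, ε)` some `κ > 0` prices
EVERY `p`-periodic Hägg word `s`: `κ·#U_Q ≤ p·(e(Q) − e(hcp a₀ h₀))`,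
`Q = barlowPeriodicConfiguration s ha hh hp hs`.  Proof: `δ, K` from the geometry,
`κ = min (|J₂|/(2(2K+1))) (c δ²)`; `p(e(Q) − e(hcp a h)) = H_p(s) − p·Σ_even J ≥ b_p·γ ≥ b_p|J₂|/2`
(3065 for `s` and for `alternatingHagg` with `p = 2`, `haggEnergy_alternating`; the word excess),
`e(hcp a h) ≥ e(hcp a₀ h₀) + c((a−a₀)² + (h−h₀)²)` (modulus); if `|a−a₀| ≤ δ ∧ |h−h₀| ≤ δ` then
`#U ≤ (2K+1) b_p`, else `#U ≤ p` (`natCard_motif_subtype_le`) and `(a−a₀)² + (h−h₀)² ≥ δ²`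
(`sq_le_of_not_close`); conclude by `pricing_arith`. [folklore] -/
theorem stub_idealPolytypePricing : (∀ (J : ℕ → ℝ) (s : ℤ → ℤ) (p : ℕ), p ≠ 0 → (∀ i : ℤ, s i = 1 ∨ s i = -1) → (∀ i : ℤ, s (i + p) = s i) → Summable (fun k : ℕ => (k : ℝ) * |J k|) → (p : ℝ) * (∑' k : ℕ, (if 2 ≤ k ∧ Even k then J k else 0)) + (((Finset.range p).filter (fun m : ℕ => s ((m : ℤ) + 1) = s m)).card : ℝ) * (-J 2 - ∑' k : ℕ, (if 3 ≤ k then ((k : ℝ) - 1) * |J k| else 0)) ≤ Literature.MathematicalPhysics.StatisticalMechanics.haggEnergy p J s) → (∀ (a₀ h₀ : ℝ), 0 < a₀ → 0 < h₀ → ∀ R ε : ℝ, 0 < R → 0 < ε → ∃ δ : ℝ, 0 < δ ∧ ∃ K : ℕ, ∀ (a h : ℝ) (ha : a ≠ 0) (hh : h ≠ 0), |a - a₀| ≤ δ → |h - h₀| ≤ δ → ∀ (p : ℕ) (hp : p ≠ 0) (s : ℤ → ℤ) (hs : ∀ i : ℤ, s (i + p) = s i), Literature.MathematicalPhysics.StatisticalMechanics.IsHaggSeq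 s → (Nat.card {x : (Literature.MathematicalPhysics.StatisticalMechanics.barlowPeriodicConfiguration s ha hh hp hs).motif // ¬ ∃ g : EuclideanSpace ℝ (Fin 3) ≃ᵃⁱ[ℝ] EuclideanSpace ℝ (Fin 3), (∀ j : (Literature.MathematicalPhysics.StatisticalMechanics.barlowPeriodicConfiguration s ha hh hp hs).points, dist ((Subtype.val : (Literature.MathematicalPhysics.StatisticalMechanics.barlowPeriodicConfiguration s ha hh hp hs).points → EuclideanSpace ℝ (Fin 3)) ⟨x.1, (Literature.MathematicalPhysics.StatisticalMechanics.barlowPeriodicConfiguration s ha hh hp hs).mem_points_of_mem_motif x.2⟩) ((Subtype.val : (Literature.MathematicalPhysics.StatisticalMechanics.barlowPeriodicConfiguration s ha hh hp hs).points → EuclideanSpace ℝ (Fin 3)) j) ≤ R → ∃ z ∈ Literature.MathematicalPhysics.StatisticalMechanics.barlowStacking a₀ h₀ Literature.MathematicalPhysics.StatisticalMechanics.alternatingHagg, dist ((Subtype.val : (Literature.MathematicalPhysics.StatisticalMechanics.barlowPeriodicConfiguration s ha hh hp hs).points → EuclideanSpace ℝ (Fin 3)) j) (g z) ≤ ε)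 ∧ (∀ z ∈ Literature.MathematicalPhysics.StatisticalMechanics.barlowStacking a₀ h₀ Literature.MathematicalPhysics.StatisticalMechanics.alternatingHagg, dist ((Subtype.val : (Literature.MathematicalPhysics.StatisticalMechanics.barlowPeriodicConfiguration s ha hh hp hs).points → EuclideanSpace ℝ (Fin 3)) ⟨x.1, (Literature.MathematicalPhysics.StatisticalMechanics.barlowPeriodicConfiguration s ha hh hp hs).mem_points_of_mem_motif x.2⟩) (g z) ≤ R → ∃ j : (Literature.MathematicalPhysics.StatisticalMechanics.barlowPeriodicConfiguration s ha hh hp hs).points, dist ((Subtype.val : (Literature.MathematicalPhysics.StatisticalMechanics.barlowPeriodicConfiguration s ha hh hp hs).points → EuclideanSpace ℝ (Fin 3)) j) (g z) ≤ ε)} : ℝ) ≤ (2 * (K : ℝ) + 1) * (((Finset.range p).filter (fun m : ℕ => s ((m : ℤ) + 1) = s m)).card : ℝ)) → Summit.AtomisticToContinuum.Crystallization.Theses.PoissonBesselStacking.BarlowEnergyIdentification → ∀ (a₀ h₀ : ℝ) (ha₀ : a₀ ≠ 0) (hh₀ : h₀ ≠ 0) (c : ℝ), 0 < c → (47 / 50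 ≤ a₀ ∧ a₀ ≤ 1 ∧ 39 / 50 * a₀ ≤ h₀ ∧ h₀ ≤ 17 / 20 * a₀) → (∀ (a h : ℝ) (ha : a ≠ 0) (hh : h ≠ 0), 47 / 50 ≤ a ∧ a ≤ 1 ∧ 39 / 50 * a ≤ h ∧ h ≤ 17 / 20 * a → (Literature.MathematicalPhysics.StatisticalMechanics.hcpPeriodicConfiguration ha₀ hh₀).energyPerParticle Literature.MathematicalPhysics.StatisticalMechanics.lennardJones + c * ((a - a₀) ^ 2 + (h - h₀) ^ 2) ≤ (Literature.MathematicalPhysics.StatisticalMechanics.hcpPeriodicConfiguration ha hh).energyPerParticle Literature.MathematicalPhysics.StatisticalMechanics.lennardJones) → ∀ (a h : ℝ) (ha : a ≠ 0) (hh : h ≠ 0), (47 / 50 ≤ a ∧ a ≤ 1 ∧ 39 / 50 * a ≤ h ∧ h ≤ 17 / 20 * a) → (Summable (fun k : ℕ => (k : ℝ) * |Literature.MathematicalPhysics.StatisticalMechanics.barlowCoupling Literature.MathematicalPhysics.StatisticalMechanics.lennardJones a h k|) ∧ Literature.MathematicalPhysics.StatisticalMechanics.barlowCoupling Literature.MathematicalPhysics.StatisticalMechanics.lennardJones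 a h 2 < 0 ∧ ∑' k : ℕ, (if 3 ≤ k then ((k : ℝ) - 1) * |Literature.MathematicalPhysics.StatisticalMechanics.barlowCoupling Literature.MathematicalPhysics.StatisticalMechanics.lennardJones a h k| else 0) ≤ (1 / 2) * |Literature.MathematicalPhysics.StatisticalMechanics.barlowCoupling Literature.MathematicalPhysics.StatisticalMechanics.lennardJones a h 2|) → ∀ R ε : ℝ, 0 < R → 0 < ε → ∃ κ : ℝ, 0 < κ ∧ ∀ (p : ℕ) (hp : p ≠ 0) (s : ℤ → ℤ) (hs : ∀ i : ℤ, s (i + p) = s i), Literature.MathematicalPhysics.StatisticalMechanics.IsHaggSeq s → κ * (Nat.card {x : (Literature.MathematicalPhysics.StatisticalMechanics.barlowPeriodicConfiguration s ha hh hp hs).motif // ¬ ∃ g : EuclideanSpace ℝ (Fin 3) ≃ᵃⁱ[ℝ] EuclideanSpace ℝ (Fin 3), (∀ j : (Literature.MathematicalPhysics.StatisticalMechanics.barlowPeriodicConfiguration s ha hh hp hs).points, dist ((Subtype.val : (Literature.MathematicalPhysics.StatisticalMechanics.barlowPeriodicConfiguration s ha hh hp hs).points → EuclideanSpace ℝ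 (Fin 3)) ⟨x.1, (Literature.MathematicalPhysics.StatisticalMechanics.barlowPeriodicConfiguration s ha hh hp hs).mem_points_of_mem_motif x.2⟩) ((Subtype.val : (Literature.MathematicalPhysics.StatisticalMechanics.barlowPeriodicConfiguration s ha hh hp hs).points → EuclideanSpace ℝ (Fin 3)) j) ≤ R → ∃ z ∈ Literature.MathematicalPhysics.StatisticalMechanics.barlowStacking a₀ h₀ Literature.MathematicalPhysics.StatisticalMechanics.alternatingHagg, dist ((Subtype.val : (Literature.MathematicalPhysics.StatisticalMechanics.barlowPeriodicConfiguration s ha hh hp hs).points → EuclideanSpace ℝ (Fin 3)) j) (g z) ≤ ε) ∧ (∀ z ∈ Literature.MathematicalPhysics.StatisticalMechanics.barlowStacking a₀ h₀ Literature.MathematicalPhysics.StatisticalMechanics.alternatingHagg, dist ((Subtype.val : (Literature.MathematicalPhysics.StatisticalMechanics.barlowPeriodicConfiguration s ha hh hp hs).points → EuclideanSpace ℝ (Fin 3)) ⟨x.1, (Literature.MathematicalPhysics.StatisticalMechanics.barlowPeriodicConfiguration s ha hh hp hs).mem_points_of_mem_motif x.2⟩) (g z) ≤ R → ∃ j : (Literature.MathematicalPhysics.StatisticalMechanics.barlowPeriodicConfiguration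 s ha hh hp hs).points, dist ((Subtype.val : (Literature.MathematicalPhysics.StatisticalMechanics.barlowPeriodicConfiguration s ha hh hp hs).points → EuclideanSpace ℝ (Fin 3)) j) (g z) ≤ ε)} : ℝ) ≤ (p : ℝ) * ((Literature.MathematicalPhysics.StatisticalMechanics.barlowPeriodicConfiguration s ha hh hp hs).energyPerParticle Literature.MathematicalPhysics.StatisticalMechanics.lennardJones - (Literature.MathematicalPhysics.StatisticalMechanics.hcpPeriodicConfiguration ha₀ hh₀).energyPerParticle Literature.MathematicalPhysics.StatisticalMechanics.lennardJones) := by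
  intro hExcess hGeom hBEI a₀ h₀ ha₀ hh₀ c hc hbox₀ hMod a h ha hh hbox hD R ε hR hε
  have ha₀pos : 0 < a₀ := by linarith [hbox₀.1]
  have hh₀pos : 0 < h₀ := by linarith [hbox₀.1, hbox₀.2.2.1]
  have hapos : 0 < a := by linarith [hbox.1]
  have hhpos : 0 < h := by linarith [hbox.1, hbox.2.2.1]
  obtain ⟨δ, hδ, K, hK⟩ := hGeom a₀ h₀ ha₀pos hh₀pos R ε hR hε
  obtain ⟨hsum, hJ2, hdom⟩ := hD
  have hJ2abs : 0 < |barlowCoupling lennardJones a h 2| := abs_pos.2 hJ2.ne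
  refine ⟨min (|barlowCoupling lennardJones a h 2| / (2 * (2 * (K : ℝ) + 1))) (c * δ ^ 2),
    lt_min (by positivity) (by positivity), ?_⟩
  intro p hp s hs hHagg
  have hp0 : (0 : ℝ) < p := by exact_mod_cast Nat.pos_of_ne_zero hp
  -- energy identification (item 3065) for the word `s` …
  have hE := hBEI a h hapos hhpos s p ha hh hp hs hHagg
  -- … and for the alternating word (period 2): `e(hcp a h) = e₀ + Σ_{k ≥ 2 even} J_k`
  have hEhcp : (hcpPeriodicConfiguration ha hh).energyPerParticle lennardJones =
      barlowBaseEnergy lennardJones a h +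
        ∑' k : ℕ, (if 2 ≤ k ∧ Even k then barlowCoupling lennardJones a h k else 0) := by
    have h2 := hBEI a h hapos hhpos alternatingHagg 2 ha hh two_ne_zero alternatingHagg_periodic
      isHaggSeq_alternating
    rw [haggEnergy_alternating, Nat.cast_ofNat, mul_div_cancel_left₀ _ two_ne_zero] at h2
    exact h2
  -- the word excess per period and the modulus at `(a, h)`
  have hword := hExcess (barlowCoupling lennardJones a h) s p hp hHagg hs hsum
  have hmod := hMod a h ha hh hbox
  exact pricing_arith (Close := |a - a₀| ≤ δ ∧ |h - h₀| ≤ δ) (Nat.cast_nonneg _)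
    (natCard_motif_subtype_le ha hh hp hs _) (Nat.cast_nonneg _) hp0 hJ2 hdom hword hE hEhcp hmod
    hc hδ (by positivity) (fun hcl => hK a h ha hh hcl.1 hcl.2 p hp s hs hHagg)
    (fun hcl => sq_le_of_not_close hδ hcl)

end Summit.AtomisticToContinuum.Crystallization.Theorems.PricedHcpWindowsIdealPricing
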